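import Literature.MathematicalPhysics.QuantumFieldTheory.Balaban1983to89.Node00.U3OfKernels
import Literature.MathematicalPhysics.QuantumFieldTheory.Balaban1983to89.Node00.Record13Chi

/-!
# NODE 00 ∕ W1 — NODE U3's OBJECTS OF RECORD KEYED TO THE LIMITING (1.21) KERNELS, RE-ISSUED GENERIC IN THE β-SLOT χ («Chi») WITH THE RE-CENTRED («Ax»)
# INSTANCE: `objectsOfRecord₁₃Chi θ χ ℓ`, its faces, `representsA∕B` FOR `betaOfRecord₁₃Chi θ χ`, the (5.10) clause `KernelDecayOfRecord₁₃Chi` — §5 of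
# `Node00/U3OfKernels` under exactly the substitutions of [Ax-3b] `Node00/Record13Chi` (`chiβOfRecord₁₃ F N θ ↦ χ`, `betaOfRecord₁₃ F N θ ↦ betaOfRecord₁₃Chi F N θ χ`,
# names `X ↦ XChi`, rows `↦ …_chi`), receipts at `χ := chiβOfRecord₁₃ θ` (`rfl`) and Ax abbrevs at `χ := chiβOfRecord₁₃Ax θ`

WHY (WORK ORDER RC-1, director-ym №462∕№467; op 5c of K3ᴬ `SpineGivenEndpointR13SepCoPHVAx` stmt-QuantumFields-27247; dag-n16-e ⚑ LOCATED pub-ymgap INBOX l.21817).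
`objectsOfRecord₁₃ θ ℓ` (parent :454) reads the merged term family AT THE CHOICE-CENTRED cut-off `chiβOfRecord₁₃ θ` and its run-A∕run-B functionals represent
`betaOfRecord₁₃ θ` (:480∕:490); the re-centred record's datum `datumOfRecord₁₃CoPHAx` reads `betaOfRecord₁₃Ax θ`.  A K3 skeleton over the Ax record that pins node U3's
objects must pin them to the kernels of the SAME cut-off its datum reads — `objectsOfRecord₁₃Ax` below — for the N18 rows (`BoxwiseConstant θ.γ (betaOfRecord₁₃Ax …)`) and
the (D4) read-out (`ReadOutAt (datumOfRecord₁₃CoPHAx …) …`) to have parents.  Every body below is the parent's VERBATIM with χ for `chiβOfRecord₁₃ F N θ`.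

HONEST FRAMING.  Definitions re-issued over a parameter + `rfl`∕bookkeeping rows; nothing of Bałaban asserted, ported or discharged; the (5.10) clause stays a HYPOTHESIS
(binder); no `sorry`∕`instance`∕`notation`; standard axioms; K0ᴬ∕K1ᴬ∕K3ᴬ OPEN; the Yang–Mills mass gap (Clay) is NOT proved by any of this.
-/

noncomputable section

namespace Literature.MathematicalPhysics.QuantumFieldTheory.Balaban1983to89.Node00.U3OfKernels

open scoped BigOperators
open T4Continuum (T4Family)
open T4OutputRate (Carriers Functional Window NE9)
open T4BetaReadOut (RepresentsA RepresentsB)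
open B12Sec2to5 (l1 Decay510)
open FlowStep (Box HBeta)

/-! ## §5χ. At the record, Stage 13, β-slot χ: the objects keyed to the limiting kernels of the merged term family at χ -/

section RecordChi

open scoped Matrix.Norms.L2Operator

variable (F : T4Family) (N : ℕ) [NeZero N]

/-- **NODE U3's OBJECTS OF RECORD, Stage 13, β-SLOT χ** — `objects` at the merged term family `mergedTermFamilyMatT F N (TβOfRecord₁₃ F N) χ θ.εbg` in the record's
β-chart `(θ.ρ8, θ.bV)`, letter block `ℓ`; the parent `objectsOfRecord₁₃` is the instance `χ := chiβOfRecord₁₃ θ` (`objectsOfRecord₁₃Chi_chiβ`).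
[cite: Balaban1987RG1, (1.20)–(1.22) p.264 and (1.6) p.261; Balaban1988RG2Cluster, (2.13) p.14, (2.14) p.15 (objects; the pairing is NOT printed)] -/
def objectsOfRecord₁₃Chi (θ : Stage13Params F N) (χ : ChiSlot F N) (ℓ : U3Letters₁₁) : U3Objects₁₁ :=
  letI := θ.instVβ₁; letI := θ.instVβ₂; letI := θ.instιβ
  objects F (mergedTermFamilyMatT F N (TβOfRecord₁₃ F N) χ θ.εbg) θ.ρ8 θ.bV ℓ

/-- Receipt: at the record's β-slot the χ-generic objects ARE the objects of record (definitional). [cite: Balaban1987RG1, (1.20)–(1.22) p.264 (bookkeeping)] -/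
theorem objectsOfRecord₁₃Chi_chiβ (θ : Stage13Params F N) (ℓ : U3Letters₁₁) :
    objectsOfRecord₁₃Chi F N θ (chiβOfRecord₁₃ F N θ) ℓ = objectsOfRecord₁₃ F N θ ℓ := rfl

/-- Face (`rfl`): the level carriers are the kernel carrier. [cite: Balaban1987RG1, (1.20)–(1.22) p.264 (bookkeeping)] -/
@[simp] theorem objectsOfRecord₁₃Chi_levelCarriers (θ : Stage13Params F N) (χ : ChiSlot F N) (ℓ : U3Letters₁₁) (k : ℕ) :
    (objectsOfRecord₁₃Chi F N θ χ ℓ).levelCarriers k = carriers := rfl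

/-- Face (`rfl`): the letter block. [cite: Balaban1987RG1, (1.20)–(1.22) p.264 (bookkeeping)] -/
@[simp] theorem objectsOfRecord₁₃Chi_toU3Letters₁₁ (θ : Stage13Params F N) (χ : ChiSlot F N) (ℓ : U3Letters₁₁) :
    (objectsOfRecord₁₃Chi F N θ χ ℓ).toU3Letters₁₁ = ℓ := rfl

/-- Face (`rfl`): run A's level functional at a carrier point is the limiting kernel of the merged term at χ. [cite: Balaban1987RG1, (1.21) p.264 and (1.6) p.261 (bookkeeping)] -/
theorem objectsOfRecord₁₃Chi_EA_pt (θ : Stage13Params F N) (χ : ChiSlot F N) (ℓ : U3Letters₁₁) (j : ℕ) (g : ℕ → ℝ) (U : PUnit) (k : ℕ) (μ ν : Fin 4)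
    (z : Fin 4 → ℤ) :
    (objectsOfRecord₁₃Chi F N θ χ ℓ).EA j g U (pt k μ ν z) =
      (letI := θ.instVβ₁; letI := θ.instVβ₂; letI := θ.instιβ
       polLimit F (k + 1) (fun K => mergedTermFamilyMatT F N (TβOfRecord₁₃ F N) χ θ.εbg k (histPrefix g k) K) θ.ρ8 θ.bV μ ν z) :=
  rfl

/-- The χ-generic objects are POPULATED. [cite: Balaban1987RG1, (0.24)–(0.25) p.257 (bookkeeping)] -/
theorem objectsOfRecord₁₃Chi_populated (θ : Stage13Params F N) (χ : ChiSlot F N) (ℓ : U3Letters₁₁) : (objectsOfRecord₁₃Chi F N θ χ ℓ).Populated :=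
  fun _ => ⟨((0 : ℕ), (0 : Fin 4), (0 : Fin 4), (0 : Fin 4 → ℤ))⟩

/-- ★★★ **`RepresentsA` FOR THE χ-GENERIC β-FUNCTIONS `betaOfRecord₁₃Chi F N θ χ` HOLDS BY CONSTRUCTION** at the χ-generic objects (every level; NO hypothesis).
[cite: Balaban1987RG1, (1.20)–(1.22) p.264 (bookkeeping)] -/
theorem representsA_objectsOfRecord₁₃_chi (θ : Stage13Params F N) (χ : ChiSlot F N) (ℓ : U3Letters₁₁) (k : ℕ) :
    RepresentsA ((objectsOfRecord₁₃Chi F N θ χ ℓ).EA k)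
      (fun j F' => B12Beta.secondMoment (fun μ ν z => F' (((objectsOfRecord₁₃Chi F N θ χ ℓ).levelCarriers k).transport (bg j μ ν z)) (pt j μ ν z)) 0 1)
      θ.γ (betaOfRecord₁₃Chi F N θ χ) := by
  letI := θ.instVβ₁; letI := θ.instVβ₂; letI := θ.instιβ
  exact representsA_objects F (mergedTermFamilyMatT F N (TβOfRecord₁₃ F N) χ θ.εbg) θ.ρ8 θ.bV ℓ
    (beta0OfMerged (betaMerged F (mergedTermFamilyMatT F N (TβOfRecord₁₃ F N) χ θ.εbg) θ.ρ8 θ.bV) θ.v₀) θ.γ k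

/-- ★★★ **`RepresentsB` FOR `betaOfRecord₁₃Chi F N θ χ` HOLDS BY CONSTRUCTION** (run-B twin; NO hypothesis).
[cite: Balaban1987RG1, (1.20)–(1.22) p.264 (bookkeeping; the re-indexing is NOT printed)] -/
theorem representsB_objectsOfRecord₁₃_chi (θ : Stage13Params F N) (χ : ChiSlot F N) (ℓ : U3Letters₁₁) (k : ℕ) :
    RepresentsB ((objectsOfRecord₁₃Chi F N θ χ ℓ).EB k)
      (fun j G => B12Beta.secondMoment (fun μ ν z => G (bg j μ ν z) (pt j μ ν z)) 0 1)
      θ.γ (betaOfRecord₁₃Chi F N θ χ) := by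
  letI := θ.instVβ₁; letI := θ.instVβ₂; letI := θ.instιβ
  exact representsB_objects F (mergedTermFamilyMatT F N (TβOfRecord₁₃ F N) χ θ.εbg) θ.ρ8 θ.bV ℓ
    (beta0OfMerged (betaMerged F (mergedTermFamilyMatT F N (TβOfRecord₁₃ F N) χ θ.εbg) θ.ρ8 θ.bV) θ.v₀) θ.γ k

/-- **THE (5.10)-CLASS CLAUSE AT β-SLOT χ** (binder only): the limiting kernels of the merged term at χ decay at the `k`-uniform rate `κ` along every coupling
sequence of the window. [cite: Balaban1987RG1, (5.10) p.293] -/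
def KernelDecayOfRecord₁₃Chi (θ : Stage13Params F N) (χ : ChiSlot F N) (μ ν : Fin 4) (κ : ℝ) : Prop :=
  letI := θ.instVβ₁; letI := θ.instVβ₂; letI := θ.instιβ
  KernelDecay F (mergedTermFamilyMatT F N (TβOfRecord₁₃ F N) χ θ.εbg) θ.ρ8 θ.bV (Window θ.γ) μ ν κ

/-- Receipt: at the record's β-slot the χ-generic (5.10) clause IS the clause of record (`Iff.rfl`). [cite: Balaban1987RG1, (5.10) p.293 (bookkeeping)] -/
theorem kernelDecayOfRecord₁₃Chi_chiβ_iff (θ : Stage13Params F N) (μ ν : Fin 4) (κ : ℝ) :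
    KernelDecayOfRecord₁₃Chi F N θ (chiβOfRecord₁₃ F N θ) μ ν κ ↔ KernelDecayOfRecord₁₃ F N θ μ ν κ := Iff.rfl

/-- `KernelDecayOfRecord₁₃Chi` IS the run-A decay clause `hdecA` of the kernel-slice read-out at the χ-generic objects (`Iff.rfl`).
[cite: Balaban1987RG1, (5.10) p.293 (bookkeeping)] -/
theorem kernelDecayOfRecord₁₃Chi_iff (θ : Stage13Params F N) (χ : ChiSlot F N) (ℓ : U3Letters₁₁) (j : ℕ) (μ ν : Fin 4) (κ : ℝ) :
    KernelDecayOfRecord₁₃Chi F N θ χ μ ν κ ↔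
      ∀ g ∈ Window θ.γ, ∃ C₀ : ℝ, ∀ k,
        Decay510 (fun z => (objectsOfRecord₁₃Chi F N θ χ ℓ).EA j g (((objectsOfRecord₁₃Chi F N θ χ ℓ).levelCarriers j).transport (bg k μ ν z)) (pt k μ ν z))
          C₀ κ :=
  Iff.rfl

/-- At the χ-generic objects the run-B decay clause `hdecB` FOLLOWS from `KernelDecayOfRecord₁₃Chi`. [cite: Balaban1987RG1, Thm 1 p.259 and (5.10) p.293 (bookkeeping)] -/
theorem kernelDecayB_objectsOfRecord₁₃_chi (θ : Stage13Params F N) (χ : ChiSlot F N) (ℓ : U3Letters₁₁) (j : ℕ) {μ ν : Fin 4} {κ : ℝ}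
    (h : KernelDecayOfRecord₁₃Chi F N θ χ μ ν κ) :
    ∀ b : ℝ, 0 < b → b ≤ θ.γ → ∀ g ∈ Window θ.γ, ∃ C₀ : ℝ, ∀ k,
      Decay510 (fun z => (objectsOfRecord₁₃Chi F N θ χ ℓ).EB j b g (bg k μ ν z) (pt k μ ν z)) C₀ κ := by
  letI := θ.instVβ₁; letI := θ.instVβ₂; letI := θ.instιβ
  exact kernelDecayB_of_kernelDecay F (mergedTermFamilyMatT F N (TβOfRecord₁₃ F N) χ θ.εbg) θ.ρ8 θ.bV h

/-! ### The RE-CENTRED instances (`χ := chiβOfRecord₁₃Ax θ`) -/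

/-- **NODE U3's OBJECTS OF THE RE-CENTRED RECORD** (instance `χ := chiβOfRecord₁₃Ax θ`): their run-A∕run-B functionals represent `betaOfRecord₁₃Ax F N θ`.
[cite: Balaban1987RG1, (1.20)–(1.22) p.264] -/
abbrev objectsOfRecord₁₃Ax (θ : Stage13Params F N) (ℓ : U3Letters₁₁) : U3Objects₁₁ := objectsOfRecord₁₃Chi F N θ (chiβOfRecord₁₃Ax F N θ) ℓ

/-- **The (5.10)-class clause of the RE-CENTRED record** (binder only). [cite: Balaban1987RG1, (5.10) p.293] -/
abbrev KernelDecayOfRecord₁₃Ax (θ : Stage13Params F N) (μ ν : Fin 4) (κ : ℝ) : Prop := KernelDecayOfRecord₁₃Chi F N θ (chiβOfRecord₁₃Ax F N θ) μ ν κ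

/-- ★ `RepresentsA` for `betaOfRecord₁₃Ax` at the re-centred objects (the χ-generic row at the Ax slot; `betaOfRecord₁₃Chi θ (chiβOfRecord₁₃Ax θ)` IS `betaOfRecord₁₃Ax θ`,
`Record13Chi` `betaOfRecord₁₃Chi_chiβAx`). [cite: Balaban1987RG1, (1.20)–(1.22) p.264 (bookkeeping)] -/
theorem representsA_objectsOfRecord₁₃Ax (θ : Stage13Params F N) (ℓ : U3Letters₁₁) (k : ℕ) :
    RepresentsA ((objectsOfRecord₁₃Ax F N θ ℓ).EA k)
      (fun j F' => B12Beta.secondMoment (fun μ ν z => F' (((objectsOfRecord₁₃Ax F N θ ℓ).levelCarriers k).transport (bg j μ ν z)) (pt j μ ν z)) 0 1)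
      θ.γ (betaOfRecord₁₃Ax F N θ) :=
  representsA_objectsOfRecord₁₃_chi F N θ (chiβOfRecord₁₃Ax F N θ) ℓ k

/-- ★ `RepresentsB` for `betaOfRecord₁₃Ax` at the re-centred objects. [cite: Balaban1987RG1, (1.20)–(1.22) p.264 (bookkeeping)] -/
theorem representsB_objectsOfRecord₁₃Ax (θ : Stage13Params F N) (ℓ : U3Letters₁₁) (k : ℕ) :
    RepresentsB ((objectsOfRecord₁₃Ax F N θ ℓ).EB k)
      (fun j G => B12Beta.secondMoment (fun μ ν z => G (bg j μ ν z) (pt j μ ν z)) 0 1)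
      θ.γ (betaOfRecord₁₃Ax F N θ) :=
  representsB_objectsOfRecord₁₃_chi F N θ (chiβOfRecord₁₃Ax F N θ) ℓ k

end RecordChi

end Literature.MathematicalPhysics.QuantumFieldTheory.Balaban1983to89.Node00.U3OfKernels

end
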